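import Literature.Probability.Percolation.LongRangeDecoupling
import HarnessLib

/-!
# Long-range bond percolation on `ℤ`: all scales, the escape bound, and the two inputs

Topic `Literature/Probability/Percolation`; last probabilistic companion of `LongRangeModel.lean`
(Duminil-Copin–Garban–Tassion, AIHP 60 (2024), §2.4, proof of Thm. 1(ii)).

## Contents (all proved)

* `bridgeTheta_anti`, `div_sq_anti`, and the iteration `inv_le_real_compl_cross_pow`:
  `P((cross (Cⁿ K₀) c)ᶜ) ≥ 1/C` at all scales ("by induction, `p̄(K_n) ≥ C⁻¹`");
* `longClosed_eq_iInter`, `measurableSet_longClosed`, `exp_le_real_longClosed`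
  (`P(B(K)) ≥ e^{-152β'}`), `measurableSet_escape`, and the **escape bound** `real_escape_le`:
  `P(A(K)) ≤ 1 - e^{-152β'} t²` ("by independence, `P[B(K_n)] p̄(K_n)² ≤ 1 - P[A(K_n)]`");
* the two inputs of the final argument: `exists_decay_of_limsup_lt` (`limsup K_n n² < β'` gives
  `K_n ≤ β'/n²` eventually) and `percolatesAt_zero_eq_iInter_exits`, `exists_real_exits_le`
  (`P(|C(0)| = ∞) < θ₁` gives a radius `R` with `P(0 exits its R-ball) ≤ θ₁`, DGT's (ojs)).

## References

* H. Duminil-Copin, C. Garban, V. Tassion, *Long-range models in 1D revisited*, Ann. Inst.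
  H. Poincaré Probab. Statist. 60 (2024), arXiv:2011.04642: §2.4 (Thm. 1(ii), Lemma 3).
* M. Aizenman, C. M. Newman, *Discontinuity of the percolation density in one-dimensional
  `1/|x-y|²` percolation models*, Comm. Math. Phys. 107 (1986) 611–647: §1, Prop. 1.1.
-/

noncomputable section

namespace Literature.Probability.Percolation

open MeasureTheory SimpleGraph Filter Literature.Probability.LatticeModels
open scoped ENNReal Topology

/-! ### Iterating the renormalisation step along the scales `Cⁿ K₀` -/

/-- `θ₂²` is non-increasing in the scale. [folklore] -/
theorem bridgeTheta_anti {β' : ℝ} (hβ : 0 ≤ β') (θ₁ : ℝ) {k k' : ℕ} (R : ℕ) (hk : 1 ≤ k)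
    (hkk' : k ≤ k') : bridgeTheta β' θ₁ k' R ≤ bridgeTheta β' θ₁ k R := by
  unfold bridgeTheta
  have hk0 : (0 : ℝ) < k := by exact_mod_cast hk
  have hkk : (k : ℝ) ≤ k' := by exact_mod_cast hkk'
  gcongr

/-- `β'/k²` is non-increasing in `k ≥ 1`. [folklore] -/
theorem div_sq_anti {β' : ℝ} (hβ : 0 ≤ β') {k k' : ℕ} (hk : 1 ≤ k) (hkk' : k ≤ k') :
    β' / (k' : ℝ) ^ 2 ≤ β' / (k : ℝ) ^ 2 := by
  have hk0 : (0 : ℝ) < k := by exact_mod_cast hk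
  have hkk : (k : ℝ) ≤ k' := by exact_mod_cast hkk'
  gcongr

/-- **Renormalisation along the scales `K_n = Cⁿ K₀`** (DGT20, proof of Thm. 1(ii): "By
induction, we deduce that `p̄(K_n) ≥ C⁻¹` for every `n ≥ 1`"): if the hypotheses of the one-step
lemma hold at the scale `K₀` (they then hold at every larger scale) and every block of scale `K₀`
fails to be crossed with probability `≥ 1/C`, then so does every block of every scale `Cⁿ K₀`.
[cite: DuminilcopinGarbanTassion2024, §2.4 (proof of Thm. 1(ii))] -/
theorem inv_le_real_compl_cross_pow {K : ℕ → unitInterval} {β' θ₁ δ s' : ℝ} (hβ : 0 < β')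
    (hδ : 0 < δ) {k₀ C R : ℕ} (hk₀ : 1 ≤ k₀) (hC : 17 ≤ C) (hR : R ≤ k₀)
    (hdecay : ∀ n : ℕ, k₀ < n → (K n : ℝ) ≤ β' / (n : ℝ) ^ 2) (hk2 : 2 * β' ≤ ((k₀ : ℝ) + 1) ^ 2)
    (hθ : (lrMeasure K).real {ω | exits R ω 0} ≤ θ₁)
    (hsmall : bridgeTheta β' θ₁ k₀ R * (β' / (k₀ : ℝ) ^ 2) ≤ δ / (1 + δ))
    (hs' : (1 + δ) * (β' * bridgeTheta β' θ₁ k₀ R) ≤ s')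
    (hbig : 18 ≤ (C : ℝ) * (Real.exp (-(152 * β')) * (Real.exp (-s') *
      Real.exp (-(s' * Real.log C)))))
    (hbase : ∀ c : ℤ, (1 / C : ℝ) ≤ (lrMeasure K).real (cross k₀ c)ᶜ) (n : ℕ) (c : ℤ) :
    (1 / C : ℝ) ≤ (lrMeasure K).real (cross (C ^ n * k₀) c)ᶜ := by
  induction n generalizing c with
  | zero => simpa using hbase c
  | succ n ih =>
    have hC1 : 1 ≤ C := le_trans (by norm_num) hC
    have hk : k₀ ≤ C ^ n * k₀ := Nat.le_mul_of_pos_left k₀ (pow_pos (by omega) n)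
    have hk1 : 1 ≤ C ^ n * k₀ := le_trans hk₀ hk
    have hθ₂ := bridgeTheta_anti hβ.le θ₁ R hk₀ hk
    have hθ₂0 : 0 ≤ bridgeTheta β' θ₁ (C ^ n * k₀) R := bridgeTheta_nonneg hβ.le θ₁ _ R
    rw [pow_succ, mul_comm (C ^ n) C, mul_assoc]
    refine le_real_compl_cross_mul (K := K) hβ hδ hk1 hC (le_trans hR hk) (fun m hm => hdecay m ?_)
      ?_ hθ ?_ ?_ hbig (by positivity) le_rfl ih c
    · exact lt_of_le_of_lt hk hm
    · have : (k₀ : ℝ) ≤ (C ^ n * k₀ : ℕ) := by exact_mod_cast hk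
      nlinarith
    · exact le_trans (mul_le_mul hθ₂ (div_sq_anti hβ.le hk₀ hk) (by positivity)
        (bridgeTheta_nonneg hβ.le θ₁ k₀ R)) hsmall
    · exact le_trans (by gcongr) hs'

/-! ### The final-step estimate: `P(A(K)) ≤ 1 - c₁ t²` -/

/-- `B(K)` as a decreasing intersection of complements of `touched` events: all edges longer
than `K` touching `[-9K, 9K]` are closed iff, for every `N`, no open edge of length in `(K, N]`
touches `[-(4K + 5K), 4K + 5K]`. [folklore] -/
theorem longClosed_eq_iInter (K : ℕ) : longClosed K = ⋂ N : ℕ, (touched K N (5 * K) 0)ᶜ := by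
  ext ω
  simp only [longClosed, longEdges, touched, Set.mem_setOf_eq, Set.mem_iInter, Set.mem_compl_iff,
    not_exists, not_and]
  constructor
  · intro h N e he hK hN z hz hz1 hz2
    exact h e ⟨hK, z, hz, by omega, by omega⟩ he
  · rintro h e ⟨hK, z, hz, hz1, hz2⟩ he
    exact h (edgeLen e) e he hK le_rfl z hz (by omega) (by omega)

/-- `B(K)` is measurable. [folklore] -/
theorem measurableSet_longClosed (K : ℕ) : MeasurableSet (longClosed K) := by
  rw [longClosed_eq_iInter]
  exact MeasurableSet.iInter fun N => (measurableSet_touched K N (5 * K) 0).compl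

/-- **`P(B(K)) ≥ e^{-152β'}`** (DGT20, proof of Thm. 1(ii): "`P_{β,λ}[B(K_n)] ≥ c₁(β) > 0` (by a
computation very similar to (3))"): continuity of the measure along the decreasing sequence
`(touched K N (5K) 0)ᶜ` and the untouched bound.
[cite: DuminilcopinGarbanTassion2024, §2.4 (proof of Thm. 1(ii))] -/
theorem exp_le_real_longClosed {K : ℕ → unitInterval} {β' : ℝ} (hβ : 0 < β') {k : ℕ}
    (hdecay : ∀ n : ℕ, k < n → (K n : ℝ) ≤ β' / (n : ℝ) ^ 2) (hk2 : 2 * β' ≤ ((k : ℝ) + 1) ^ 2) :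
    Real.exp (-(152 * β')) ≤ (lrMeasure K).real (longClosed k) := by
  have hanti : Antitone fun N : ℕ => (touched k N (5 * k) 0)ᶜ := by
    intro N N' hNN' ω hω hω'
    obtain ⟨e, he, hK, hN, z, hz⟩ := hω'
    exact hω ⟨e, he, hK, le_trans hN hNN', z, hz⟩
  have hlim : Tendsto (fun N : ℕ => (lrMeasure K).real (touched k N (5 * k) 0)ᶜ) atTop
      (𝓝 ((lrMeasure K).real (longClosed k))) := by
    rw [longClosed_eq_iInter]
    have h := tendsto_measure_iInter_atTop (μ := lrMeasure K)
      (fun N => (measurableSet_touched k N (5 * k) 0).compl.nullMeasurableSet) hanti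
      ⟨0, measure_ne_top _ _⟩
    exact (ENNReal.tendsto_toReal (measure_ne_top _ _)).comp h
  exact ge_of_tendsto' hlim fun N => exp_le_real_compl_touched hβ hdecay hk2 le_rfl 0

/-- `A(K)` is measurable (a countable union of two-point connection events). [folklore] -/
theorem measurableSet_escape (K : ℕ) : MeasurableSet (escape K) := by
  have h : escape K = ⋃ x ∈ {x : ℤ | -(3 * K : ℤ) ≤ x ∧ x ≤ 3 * K},
      ⋃ z ∈ {z : ℤ | ¬ (-(9 * K : ℤ) ≤ z ∧ z ≤ 9 * K)}, openConn x z := by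
    ext ω
    simp only [escape, openConn, Set.mem_setOf_eq, Set.mem_iUnion, exists_prop]
    constructor
    · rintro ⟨x, z, hx, hz, hr⟩; exact ⟨x, hx, z, hz, hr⟩
    · rintro ⟨x, hx, z, hz, hr⟩; exact ⟨x, z, hx, hz, hr⟩
  rw [h]
  exact MeasurableSet.biUnion (Set.to_countable _) fun x _ =>
    MeasurableSet.biUnion (Set.to_countable _) fun z _ => measurableSet_openConn_holds x z

/-- **`P(A(K)) ≤ 1 - e^{-152β'} t²`** whenever every block of scale `K` fails to be crossed with
probability `≥ t` (DGT20, proof of Thm. 1(ii): "by independence,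
`P[B(K_n)] p̄(K_n)² ≤ 1 - P[A(K_n)]`"): `B(K)` is determined by the long edges, the two crossing
events by the disjoint short-edge windows around `±6K`.
[cite: DuminilcopinGarbanTassion2024, §2.4 (proof of Thm. 1(ii))] -/
theorem real_escape_le {K : ℕ → unitInterval} {β' t : ℝ} (hβ : 0 < β') {k : ℕ} (hk : 1 ≤ k)
    (hdecay : ∀ n : ℕ, k < n → (K n : ℝ) ≤ β' / (n : ℝ) ^ 2) (hk2 : 2 * β' ≤ ((k : ℝ) + 1) ^ 2)
    (ht0 : 0 ≤ t) (ht : ∀ c : ℤ, t ≤ (lrMeasure K).real (cross k c)ᶜ) :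
    (lrMeasure K).real (escape k) ≤ 1 - Real.exp (-(152 * β')) * t ^ 2 := by
  set μ := lrMeasure K with hμ
  set Xp := cross k (6 * k) with hXp
  set Xm := cross k (-(6 * k)) with hXm
  -- the complement of `A(K)` contains `B(K) ∩ Xpᶜ ∩ Xmᶜ`
  have hsub : (Xpᶜ ∩ Xmᶜ) ∩ longClosed k ⊆ (escape k)ᶜ := by
    rintro ω ⟨⟨h1, h2⟩, h3⟩ hω
    rcases escape_subset k hω with (h | h) | h
    · exact h h3
    · exact h1 h
    · exact h2 h
  -- independence: short windows vs long edges, and the two windows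
  have hWp := windowEdges_finite k (6 * k)
  have hWm := windowEdges_finite k (-(6 * k))
  have hdisj : Disjoint (windowEdges k (6 * k)) (windowEdges k (-(6 * k))) :=
    disjoint_windowEdges (Or.inr (by omega))
  have hcompl : ∀ c : ℤ, DeterminedBy (cross k c)ᶜ (windowEdges k c) := by
    intro c
    rw [determinedBy_iff]
    intro ω ω' h
    rw [Set.mem_compl_iff, Set.mem_compl_iff,
      (determinedBy_iff _ _).1 (determinedBy_cross k c) ω ω' h]
  have hXpd : DeterminedBy Xpᶜ (windowEdges k (6 * k)) := hcompl _
  have hXmd : DeterminedBy Xmᶜ (windowEdges k (-(6 * k))) := hcompl _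
  have hXpm : MeasurableSet Xpᶜ := (measurableSet_cross k _).compl
  have hXmm : MeasurableSet Xmᶜ := (measurableSet_cross k _).compl
  have hBd : DeterminedBy (longClosed k)
      (↑(hWp.union hWm).toFinset : Set (Sym2 ℤ))ᶜ := by
    rw [Set.Finite.coe_toFinset, determinedBy_iff]
    intro ω ω' h
    have key : ∀ e ∈ longEdges k, (e ∈ ω ↔ e ∈ ω') := by
      intro e he
      have heW : e ∈ (windowEdges k (6 * k) ∪ windowEdges k (-(6 * k)))ᶜ := by
        rintro (hw | hw)
        · exact absurd hw.1 (not_le.2 he.1)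
        · exact absurd hw.1 (not_le.2 he.1)
      have := Set.ext_iff.1 h e
      simp only [Set.mem_inter_iff] at this
      exact ⟨fun h1 => (this.1 ⟨h1, heW⟩).1, fun h1 => (this.2 ⟨h1, heW⟩).1⟩
    simp only [longClosed, Set.mem_setOf_eq]
    exact forall₂_congr fun e he => by rw [key e he]
  have hind1 : μ.real ((Xpᶜ ∩ Xmᶜ) ∩ longClosed k) =
      μ.real (Xpᶜ ∩ Xmᶜ) * μ.real (longClosed k) := by
    refine prodBernoulli_real_inter_of_determinedBy _ (hWp.union hWm).toFinset ?_ hBd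
      (hXpm.inter hXmm) (measurableSet_longClosed k)
    rw [Set.Finite.coe_toFinset]
    exact (hXpd.mono Set.subset_union_left).inter (hXmd.mono Set.subset_union_right)
  have hind2 : μ.real (Xpᶜ ∩ Xmᶜ) = μ.real Xpᶜ * μ.real Xmᶜ :=
    prodBernoulli_real_inter_of_determinedBy_finite _ hWp hWm hdisj hXpd hXmd hXpm hXmm
  have hB := exp_le_real_longClosed (K := K) hβ hdecay hk2
  have h1 : Real.exp (-(152 * β')) * t ^ 2 ≤ μ.real (escape k)ᶜ := by
    refine le_trans ?_ (measureReal_mono hsub)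
    rw [hind1, hind2, mul_comm, sq]
    exact mul_le_mul (mul_le_mul (ht _) (ht _) ht0 measureReal_nonneg) hB (by positivity)
      (by positivity)
  rw [probReal_compl_eq_one_sub (measurableSet_escape k)] at h1
  linarith

/-! ### The inputs from `β = limsup K_n n²` and from `M = P(|C(0)| = ∞)` -/

/-- **Decay from the `limsup`**: if `limsup_n K_n n² < β'` (in `ℝ≥0∞`) then `K_n ≤ β'/n²` for
all large `n`. [cite: AizenmanNewman1986, §1 (1.6)] -/
theorem exists_decay_of_limsup_lt (K : ℕ → unitInterval) {β' : ℝ} (hβ : 0 < β')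
    (h : limsup (fun n : ℕ => ENNReal.ofReal (K n) * (n : ℝ≥0∞) ^ 2) atTop < ENNReal.ofReal β') :
    ∃ D : ℕ, ∀ n : ℕ, D ≤ n → (K n : ℝ) ≤ β' / (n : ℝ) ^ 2 := by
  have hev := Filter.eventually_lt_of_limsup_lt h
  rw [Filter.eventually_atTop] at hev
  obtain ⟨D, hD⟩ := hev
  refine ⟨max D 1, fun n hn => ?_⟩
  have hn1 : 1 ≤ n := le_trans (le_max_right _ _) hn
  have hlt := hD n (le_trans (le_max_left _ _) hn)
  have hcast : ENNReal.ofReal (K n) * (n : ℝ≥0∞) ^ 2 =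
      ENNReal.ofReal ((K n : ℝ) * (n : ℝ) ^ 2) := by
    rw [ENNReal.ofReal_mul (K n).2.1, ENNReal.ofReal_pow (Nat.cast_nonneg n),
      ENNReal.ofReal_natCast]
  rw [hcast, ENNReal.ofReal_lt_ofReal_iff hβ] at hlt
  have hn0 : (0 : ℝ) < (n : ℝ) ^ 2 := by positivity
  rw [le_div_iff₀ hn0]
  exact hlt.le

/-- The event `{|C(0)| = ∞}` is the decreasing intersection of the exit events of `0`.
[folklore] -/
theorem percolatesAt_zero_eq_iInter_exits :
    (percolatesAt (0 : ℤ) : Set (BondConfig ℤ)) = ⋂ R : ℕ, {ω | exits R ω 0} := by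
  ext ω
  simp only [percolatesAt, Set.mem_setOf_eq, Set.mem_iInter, exits, sub_zero, zero_sub]
  constructor
  · intro hinf R
    by_contra hno
    push Not at hno
    refine hinf ((Set.finite_Icc (-(R : ℤ)) R).subset fun z hz => ?_)
    have := hno z
    simp only [Set.mem_Icc]
    by_contra hz'
    exact this (by omega) hz
  · intro h hfin
    obtain ⟨R, hR⟩ : ∃ R : ℕ, ∀ z ∈ openCluster ω (0 : ℤ), z ≤ R ∧ -(R : ℤ) ≤ z := by
      obtain ⟨a, ha⟩ := hfin.bddAbove
      obtain ⟨b, hb⟩ := hfin.bddBelow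
      refine ⟨(max a (-b)).toNat, fun z hz => ⟨?_, ?_⟩⟩
      · have := ha hz; omega
      · have := hb hz; omega
    obtain ⟨z, hz, hr⟩ := h R
    have := hR z hr
    omega

/-- **Choice of `R`** (DGT20, proof of Lemma 3, (eq. ojs): "Fix `R ≥ 1` … such that
`P[0 ↔ ℤ ∖ B_R]² + … ≤ θ²`"): if `P(|C(0)| = ∞) < θ₁` then `P(0 exits its R-ball) ≤ θ₁` for some
`R`. [cite: DuminilcopinGarbanTassion2024, §2.4 (proof of Lemma 3)] -/
theorem exists_real_exits_le (K : ℕ → unitInterval) {θ₁ : ℝ}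
    (hθ : (lrMeasure K).real (percolatesAt (0 : ℤ)) < θ₁) :
    ∃ R : ℕ, (lrMeasure K).real {ω | exits R ω 0} ≤ θ₁ := by
  have hanti : Antitone fun R : ℕ => {ω : BondConfig ℤ | exits R ω 0} := by
    intro R R' hRR' ω ⟨z, hz, hr⟩
    exact ⟨z, by omega, hr⟩
  have hlim : Tendsto (fun R : ℕ => (lrMeasure K).real {ω | exits R ω 0}) atTop
      (𝓝 ((lrMeasure K).real (percolatesAt (0 : ℤ)))) := by
    rw [percolatesAt_zero_eq_iInter_exits]
    have h := tendsto_measure_iInter_atTop (μ := lrMeasure K)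
      (fun R => (measurableSet_exits R 0).nullMeasurableSet) hanti ⟨0, measure_ne_top _ _⟩
    exact (ENNReal.tendsto_toReal (measure_ne_top _ _)).comp h
  obtain ⟨R, hR⟩ := (Filter.eventually_atTop.1 (hlim.eventually_lt_const hθ))
  exact ⟨R, (hR R le_rfl).le⟩

end Literature.Probability.Percolation
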